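import Literature.AnabelianGeometry.EtaleTheta.Discharge.Sec5OfConstantsDictionary

/-!
# [EtTh] §5, Theorem 5.10 (iii) at `DK := kummerOut` with the clause `hΔ` for the ONE representative `ψY` only (pp. 334–335 / PDF pp. 108–109)

Mochizuki, *The étale theta function and its Frobenioid-theoretic manifestations*, Publ. RIMS **45** (2009)
[cite: MochizukiEtTh2009, Thm 5.10 (iii) p.334 (PDF p.108)]: "`γ` … is compatible with the `Π^tp_X`-conjugacy class of automorphisms of `Π^tp_Y`
induced by `Ψ^bs` [cf. Theorem 4.4]".  Layer L2 of the abc-iut cell, seat abc-iut-L2-t11 (gen 4); PROOF-ONLY (0 defs), additive.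

WHY.  This seat's route-(B) Theorem 5.10 (iii) files at the honest `K^×`-part (`Sec5Thm510iiiKummerOutOfDictionary.lean` p435043,
`Sec5Lem59ivOfSettingDictionary.lean` p437577, `Sec5OfConstantsDictionary.lean` p439828, junction sequel p441744) enter abc-iut-L2-d4's
Theorem 5.10 (iii) through the UNIVERSAL `hDK` binder of `monoThetaEnvCompat_of_psiAutPreserves`, and therefore ask the clause `hΔ`
«`ψ` preserves `Π^tp_Y̲ ∩ Ker(Π^tp_X̲ ↠ G_K)`» for EVERY topological automorphism `ψ` of `Π^tp_X̲` (⟸ [EtTh] Cor. 2.18 (i) in its ∀-form) — audit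
note (n2) of abc-iut-L2-t4 g4 on p437577 (STATUS 2026-08-26T11:24:54Z): "print needs it for the `ψ` induced by `Ψ^bs` only; … a producer will
want the restricted form".  Print indeed only uses the ONE representative `ψY` of "the `Π^tp_X`-conjugacy class of automorphisms of `Π^tp_Y`
induced by `Ψ^bs`" (and its `Π^tp_X̲`-conjugates / inverse, which inherit the clause: abc-iut-L6-t23's `aug_conjTop_iff`).  This file gives the
RESTRICTED form at all three levels, going through abc-iut-L2-d4's `exists_monoThetaIso_of_isEnvCompatible` for the specific compatible pair
`(κ⁻¹ ∘ Ψ^Aut, Inn(x₃⁻¹) ∘ ψY)` (as abc-iut-L6-t23 does at `DK₀`, `Sec5Thm510iiiKummerPart.lean` p417503) instead of the universal binder: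
* `BiratAutAction.exists_monoThetaIso_of_psiAutPreserves_kummerOut_of_galoisDictionary_rep` / `monoThetaEnvCompat_kummerOut_of_galoisDictionary_rep`
  — generic `T`, Galois dictionary binders `e, j, ν` as in p424113, clause `hΔY` for `ψY` ONLY;
* `BiratAutAction.monoThetaEnvCompat_kummerOut_ofSetting_rep` — against abc-iut-L2-t8's model of the setting (`T := Cu.thetaEnvData μ hC hS`), the
  `T`-side of the dictionary discharged as in p437577;
* `BiratAutAction.ConstantsDictionary.monoThetaEnvCompat_kummerOut_rep` — from the ONE binder `hD : ConstantsDictionary …` (p439403/p439828);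
  v2 (append-only): `ConstantsDictionary.thm510_ii_iii_kummerOut_rep` — Thm. 5.10 (ii) ∧ (iii) at `kummerOut` from Thm. 5.7 / Thm. 4.4 (iv)
  transports (abc-iut-L2-t4's `Facts.psiAutPreserves_of_transports`) + the ONE binder + `hΔY` (no `hsemi`, no Cor. 2.18 (i) ∀-form).
At the junction `ofThetaSettingData` the last one applies verbatim with abc-iut-L2-t4's `identifiesPiY_ofThetaSettingData`,
`kxRootNModCyclotome_ofThetaSettingData_of_constantsDictionary` and `hopenX` from temperedness (p440765), exactly as in p441744.
HONEST FRAMING: kernel-checked compositions; the dictionary and the clause `hΔY` are hypotheses; nothing of [EtTh] is asserted unconditionally;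
typed ≠ proved; no side is taken on anything downstream ([IUTchIII] Cor. 3.12).
-/

noncomputable section

namespace Literature.AnabelianGeometry.EtaleTheta

open CategoryTheory Literature.AnabelianGeometry.SemiGraphs
open scoped Pointwise

universe w u u' v'

namespace ThetaFrobenioid

variable {C₀ : Type u} [Category.{0} C₀] {D₀ : Type u'} [Category.{v'} D₀] {𝔉 : ThetaFrobenioid.{w} C₀ D₀}

/-- If `ψ` preserves `Π^tp_Y̲` and the clause «`aug(ι(ψ y)) = 1 ↔ aug(ι y) = 1` on `Π^tp_Y̲`», then so does `ψ⁻¹` (private copy of abc-iut-L6-t23's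
helper of the same name).  [folklore] -/
private theorem aug_symm_iff' {N : ℕ+} (T : ThetaEnvData.{0} N) {M : Type*} [Group M] [TopologicalSpace M]
    (ι : M ≃ₜ* T.PiX) (PiY : Subgroup M) {ψ : M ≃ₜ* M} (hψY : PiY.map ψ.toMulEquiv.toMonoidHom = PiY)
    (hΔ : ∀ y ∈ PiY, T.aug (ι (ψ y)) = 1 ↔ T.aug (ι y) = 1) :
    ∀ y ∈ PiY, T.aug (ι (ψ.symm y)) = 1 ↔ T.aug (ι y) = 1 := by
  intro y hy
  have hy' : ψ.symm y ∈ PiY := by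
    rw [← mem_iff_of_map_equiv_eq (Φ := ψ.toMulEquiv) hψY]
    change ψ (ψ.symm y) ∈ PiY
    rwa [ψ.apply_symm_apply]
  have h := hΔ (ψ.symm y) hy'
  rw [ψ.apply_symm_apply] at h
  exact h.symm

namespace BiratAutAction

/-! ### (1) Generic `T`, Galois dictionary binders, clause for the representative only -/

section Dictionary

variable (α : 𝔉.BiratAutAction) (hK : 𝔉.KxRootNModCyclotome) (h1 : 𝔉.SectionsFactor)
  (h3 : 𝔉.OuterActionLZ) (hsec : 𝔉.SgpCapSection) (hcs : 𝔉.SgpCupSection) (h8 : 𝔉.ConstantsEqNormalizer)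
  (T : ThetaEnvData.{0} 𝔉.N) (ι : 𝔉.PiX ≃ₜ* T.PiX) (m : 𝔉.muTorsion 𝔉.BN 𝔉.N ≃* T.mu)
  {F : Type*} {L : Type*} [Field F] [Field L] [Algebra F L]
  (e : T.G ≃* (L ≃ₐ[F] L)) (j : T.mu →* Lˣ) (ν : 𝔉.KxRootN →* Lˣ)

/-- **[EtTh] Theorem 5.10 (iii) (unfolded) at `DK := kummerOut` FROM THE GALOIS DICTIONARY, clause for the REPRESENTATIVE `ψY` ONLY**:
the `γ` of print is built on abc-iut-L2-d4's compatible pair `(κ⁻¹ ∘ Ψ^Aut, Inn(x₃⁻¹) ∘ ψY)`; its two `DK`-stability obligations are this seat's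
`transport_envAut_mem_D_kummerOut_of_galoisDictionary` (p435043) for that pair and its inverse, whose clause `hΔ` follows from `hΔY` by
abc-iut-L6-t23's `aug_conjTop_iff` and the inverse rule.  [cite: MochizukiEtTh2009, Thm 5.10 (iii) p.334–335 (PDF pp.108–109)] -/
theorem exists_monoThetaIso_of_psiAutPreserves_kummerOut_of_galoisDictionary_rep [Normal F L] [NeZero ((𝔉.N : ℕ) : F)]
    (H : 𝔉.Facts) (hY : 𝔉.IdentifiesPiY T ι.toMulEquiv) (hj : Function.Injective j)
    (hjN : ∀ z : Lˣ, z ^ (𝔉.N : ℕ) = 1 → z ∈ j.range)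
    (hchi : ∀ (g : T.G) (x : T.mu), j (T.chi g x) = e g • j x)
    (hνμ : ∀ u : 𝔉.muTorsion 𝔉.BN 𝔉.N, ν ⟨𝔉.muToBirat u, 𝔉.muToBirat_mem_KxRootN u⟩ = j (m u))
    (hνeq : ∀ (f : 𝔉.KxRootN) (y : 𝔉.PiX),
      j (m (α.kummerCocycle hK f (𝔉.sgpCap (𝔉.ρ y)))) * ν f = e (T.aug (ι y)) • ν f)
    (hνN : ∀ y : Fˣ, ∃ f : 𝔉.KxRootN, ((ν f : Lˣ) : L) ^ (𝔉.N : ℕ) = algebraMap F L y)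
    (haugY : Function.Surjective T.augY) (hopen : IsOpenMap fun p : T.PiY => e (T.augY p))
    (Ψ : C₀ ≌ C₀) (β : Ψ.functor.obj 𝔉.BN ≅ 𝔉.BN) (ΨbiratAut : 𝔉.biratUnits 𝔉.BN ≃* 𝔉.biratUnits 𝔉.BN)
    (hii : 𝔉.PsiAutPreserves Ψ β ΨbiratAut) (ψY : 𝔉.PiX ≃ₜ* 𝔉.PiX)
    (hbase : ∀ g, 𝔉.autBase 𝔉.BN (𝔉.psiAut Ψ β (𝔉.sgpCap (𝔉.ρ g))) = 𝔉.ρ (ψY g))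
    (hψY : 𝔉.PiY.map ψY.toMulEquiv.toMonoidHom = 𝔉.PiY)
    (hψYdd : 𝔉.PiYdd.map ψY.toMulEquiv.toMonoidHom = 𝔉.PiYdd)
    (hΔY : ∀ y ∈ 𝔉.PiY, T.aug (ι (ψY y)) = 1 ↔ T.aug (ι y) = 1) :
    ∃ (x₃ : 𝔉.PiX) (γ : (𝔉.frdMonoThetaEnv h1 h3 hsec hcs h8 (α.kummerOut hK)).Iso
        (𝔉.frdMonoThetaEnv h1 h3 hsec hcs h8 (α.kummerOut hK))) (k : Aut 𝔉.BN),
      (∀ x, 𝔉.psiAut Ψ β (𝔉.epsilon x) = k * 𝔉.epsilon (γ.e x) * k⁻¹) ∧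
        ∀ x, 𝔉.toPiY (γ.e x) = (ψY.trans (𝔉.conjTop x₃⁻¹)) (𝔉.toPiY x) := by
  obtain ⟨hU, -, -, -, δ₁, δ₂, δ₃, hδ₁, hδ₂, hδ₃, hE, -, hcup⟩ := hii
  obtain ⟨x₃, hx₃⟩ := 𝔉.ρ_surjective (𝔉.autBase 𝔉.BN δ₃)
  have hc := isEnvCompatible_of_thm510ii h3 h8 (𝔉.psiAutEquiv Ψ β) hδ₁ (Subgroup.mem_inf.mp hδ₂).2
    hδ₃ (by rwa [psiAutEquiv_toMonoidHom]) (by rwa [psiAutEquiv_toMonoidHom])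
    (by rwa [psiAutEquiv_toMonoidHom]) ψY (fun g => hbase g) hψY hψYdd x₃ hx₃
  have hΔ₁ := 𝔉.aug_conjTop_iff T ι ψY x₃ hΔY
  have hΔ₂ := aug_symm_iff' T ι 𝔉.PiY hc.map_PiY hΔ₁
  exact ⟨x₃, exists_monoThetaIso_of_isEnvCompatible h1 h3 hsec hcs h8 _ Ψ β (δ₁ * δ₂ * δ₃) hc
    (fun a => by rw [MulEquiv.trans_apply, MulAut.conj_apply, inv_inv, psiAutEquiv_apply])
    (fun d hd => α.transport_envAut_mem_D_kummerOut_of_galoisDictionary hK h1 h3 hsec hcs h8 T ι m e j ν H hY hj hjN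
      hchi hνμ hνeq hνN haugY hopen hc hΔ₁ hd)
    (fun d hd => α.transport_envAut_mem_D_kummerOut_of_galoisDictionary hK h1 h3 hsec hcs h8 T ι m e j ν H hY hj hjN
      hchi hνμ hνeq hνN haugY hopen (hc.symm hsec) hΔ₂ hd)⟩

/-- **[EtTh] Theorem 5.10 (iii) as typed (`MonoThetaEnvCompat`) at `DK := kummerOut` FROM THE GALOIS DICTIONARY, clause for the
representative `ψY` only.**  [cite: MochizukiEtTh2009, Thm 5.10 (iii) p.334–335 (PDF pp.108–109)] -/
theorem monoThetaEnvCompat_kummerOut_of_galoisDictionary_rep [Normal F L] [NeZero ((𝔉.N : ℕ) : F)]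
    (H : 𝔉.Facts) (hY : 𝔉.IdentifiesPiY T ι.toMulEquiv) (hj : Function.Injective j)
    (hjN : ∀ z : Lˣ, z ^ (𝔉.N : ℕ) = 1 → z ∈ j.range)
    (hchi : ∀ (g : T.G) (x : T.mu), j (T.chi g x) = e g • j x)
    (hνμ : ∀ u : 𝔉.muTorsion 𝔉.BN 𝔉.N, ν ⟨𝔉.muToBirat u, 𝔉.muToBirat_mem_KxRootN u⟩ = j (m u))
    (hνeq : ∀ (f : 𝔉.KxRootN) (y : 𝔉.PiX),
      j (m (α.kummerCocycle hK f (𝔉.sgpCap (𝔉.ρ y)))) * ν f = e (T.aug (ι y)) • ν f)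
    (hνN : ∀ y : Fˣ, ∃ f : 𝔉.KxRootN, ((ν f : Lˣ) : L) ^ (𝔉.N : ℕ) = algebraMap F L y)
    (haugY : Function.Surjective T.augY) (hopen : IsOpenMap fun p : T.PiY => e (T.augY p))
    (Ψ : C₀ ≌ C₀) (β : Ψ.functor.obj 𝔉.BN ≅ 𝔉.BN) (ΨbiratAut : 𝔉.biratUnits 𝔉.BN ≃* 𝔉.biratUnits 𝔉.BN)
    (hii : 𝔉.PsiAutPreserves Ψ β ΨbiratAut) (ψY : 𝔉.PiX ≃ₜ* 𝔉.PiX)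
    (hbase : ∀ g, 𝔉.autBase 𝔉.BN (𝔉.psiAut Ψ β (𝔉.sgpCap (𝔉.ρ g))) = 𝔉.ρ (ψY g))
    (hψY : 𝔉.PiY.map ψY.toMulEquiv.toMonoidHom = 𝔉.PiY)
    (hψYdd : 𝔉.PiYdd.map ψY.toMulEquiv.toMonoidHom = 𝔉.PiYdd)
    (hΔY : ∀ y ∈ 𝔉.PiY, T.aug (ι (ψY y)) = 1 ↔ T.aug (ι y) = 1) :
    𝔉.MonoThetaEnvCompat h1 h3 hsec hcs h8 (α.kummerOut hK) Ψ β ψY hbase hψY hψYdd := by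
  obtain ⟨x₃, γ, k, hk, hγ⟩ := α.exists_monoThetaIso_of_psiAutPreserves_kummerOut_of_galoisDictionary_rep hK h1 h3 hsec hcs
    h8 T ι m e j ν H hY hj hjN hchi hνμ hνeq hνN haugY hopen Ψ β ΨbiratAut hii ψY hbase hψY hψYdd hΔY
  exact ⟨x₃, γ, k, hk, fun x => by rw [hγ x, ContinuousMulEquiv.trans_apply, conjTop_apply, inv_inv]⟩

end Dictionary

/-! ### (2) Against the model of the setting: the `T`-side of the dictionary discharged -/

section Setting

variable (α : 𝔉.BiratAutAction) (hK : 𝔉.KxRootNModCyclotome) (h1 : 𝔉.SectionsFactor)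
  (h3 : 𝔉.OuterActionLZ) (hsec : 𝔉.SgpCapSection) (hcs : 𝔉.SgpCupSection) (h8 : 𝔉.ConstantsEqNormalizer)
  {p : ℕ} [Fact p.Prime] {D : ThetaSetting p} {E : D.EtaleThetaData} {l : ℕ} (Cu : E.DoubleUnderline l)
  (μ : D.CyclotomeMod l 𝔉.N) (hC : D.Compat) (hS : D.Sec2Hyps)
  (ι : 𝔉.PiX ≃ₜ* (Cu.thetaEnvData μ hC hS).PiX) (m : 𝔉.muTorsion 𝔉.BN 𝔉.N ≃* (Cu.thetaEnvData μ hC hS).mu)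
  (ν : 𝔉.KxRootN →* (PadicAlgCl p)ˣ)

/-- **Theorem 5.10 (iii) at `DK := kummerOut` against abc-iut-L2-t8's model of the setting, clause for the representative `ψY` only**
(the `T`-side of the dictionary discharged as in this seat's `monoThetaEnvCompat_kummerOut_ofSetting`, p437577).
[cite: MochizukiEtTh2009, Thm 5.10 (iii) p.334–335 (PDF pp.108–109)] -/
theorem monoThetaEnvCompat_kummerOut_ofSetting_rep (H : 𝔉.Facts)
    (hY : 𝔉.IdentifiesPiY (Cu.thetaEnvData μ hC hS) ι.toMulEquiv)
    (hopenX : IsOpenMap fun x : D.PiTemp => (⟨D.aug x, D.aug_mem_GK x⟩ : D.GK))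
    (hνμ : ∀ u : 𝔉.muTorsion 𝔉.BN 𝔉.N,
      ν ⟨𝔉.muToBirat u, 𝔉.muToBirat_mem_KxRootN u⟩ = ((m u : MuN p 𝔉.N) : (PadicAlgCl p)ˣ))
    (hνeq : ∀ (f : 𝔉.KxRootN) (y : 𝔉.PiX),
      (((m (α.kummerCocycle hK f (𝔉.sgpCap (𝔉.ρ y))) : MuN p 𝔉.N) : (PadicAlgCl p)ˣ)) * ν f =
        (((Cu.thetaEnvData μ hC hS).aug (ι y) : D.GK) : GQp p) • ν f)
    (hνN : ∀ y : (D.K)ˣ, ∃ f : 𝔉.KxRootN,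
      ((ν f : (PadicAlgCl p)ˣ) : PadicAlgCl p) ^ (𝔉.N : ℕ) = algebraMap D.K (PadicAlgCl p) y)
    (Ψ : C₀ ≌ C₀) (β : Ψ.functor.obj 𝔉.BN ≅ 𝔉.BN) (ΨbiratAut : 𝔉.biratUnits 𝔉.BN ≃* 𝔉.biratUnits 𝔉.BN)
    (hii : 𝔉.PsiAutPreserves Ψ β ΨbiratAut) (ψY : 𝔉.PiX ≃ₜ* 𝔉.PiX)
    (hbase : ∀ g, 𝔉.autBase 𝔉.BN (𝔉.psiAut Ψ β (𝔉.sgpCap (𝔉.ρ g))) = 𝔉.ρ (ψY g))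
    (hψY : 𝔉.PiY.map ψY.toMulEquiv.toMonoidHom = 𝔉.PiY)
    (hψYdd : 𝔉.PiYdd.map ψY.toMulEquiv.toMonoidHom = 𝔉.PiYdd)
    (hΔY : ∀ y ∈ 𝔉.PiY, (Cu.thetaEnvData μ hC hS).aug (ι (ψY y)) = 1 ↔ (Cu.thetaEnvData μ hC hS).aug (ι y) = 1) :
    𝔉.MonoThetaEnvCompat h1 h3 hsec hcs h8 (α.kummerOut hK) Ψ β ψY hbase hψY hψYdd := by
  haveI : IsAlgClosure D.K (PadicAlgCl p) :=
    Literature.FieldTheory.Galois.isAlgClosure_of_intermediateField D.K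
  exact α.monoThetaEnvCompat_kummerOut_of_galoisDictionary_rep hK h1 h3 hsec hcs h8 (Cu.thetaEnvData μ hC hS) ι m
    (Literature.FieldTheory.Galois.fixingSubgroupMulEquiv D.K (AlgEquiv.refl : PadicAlgCl p ≃ₐ[D.K] PadicAlgCl p))
    (rootsOfUnity 𝔉.N (PadicAlgCl p)).subtype ν H hY (rootsOfUnity 𝔉.N (PadicAlgCl p)).subtype_injective
    (fun z hz => ThetaSetting.EtaleThetaData.DoubleUnderline.mem_range_rootsOfUnity_subtype z hz)
    (Cu.thetaEnvData_chi_dictionary μ hC hS) (fun u => (hνμ u).trans (Subgroup.subtype_apply _).symm)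
    (α.hνeq_of_smul hK Cu μ hC hS ι m ν hνeq) hνN (Cu.thetaEnvData_augY_surjective μ hC hS)
    ((Literature.FieldTheory.Galois.fixingSubgroupContinuousMulEquiv D.K
      (AlgEquiv.refl : PadicAlgCl p ≃ₐ[D.K] PadicAlgCl p)).toHomeomorph.isOpenMap.comp
      (Cu.thetaEnvData_isOpenMap_augY_of_isOpenMap_aug μ hC hS hopenX))
    Ψ β ΨbiratAut hii ψY hbase hψY hψYdd hΔY

end Setting

/-! ### (3) From the ONE binder `ConstantsDictionary` -/

namespace ConstantsDictionary

variable {α : 𝔉.BiratAutAction} {p : ℕ} [Fact p.Prime] {D : ThetaSetting p} {E : D.EtaleThetaData} {l : ℕ}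
  {Cu : E.DoubleUnderline l} {μ : D.CyclotomeMod l 𝔉.N} {hC : D.Compat} {hS : D.Sec2Hyps}
  {ι : 𝔉.PiX ≃ₜ* (Cu.thetaEnvData μ hC hS).PiX} {m : 𝔉.muTorsion 𝔉.BN 𝔉.N ≃* (Cu.thetaEnvData μ hC hS).mu}
  {Cst : Subgroup (𝔉.biratUnits 𝔉.BN)} {ν' : Cst →* (PadicAlgCl p)ˣ}
  (hD : ConstantsDictionary α Cu μ hC hS ι m Cst ν')
include hD

/-- **Theorem 5.10 (iii) at `DK := kummerOut` against the model of the setting from the ONE binder, clause for the representative `ψY`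
only** (the restricted form of `ConstantsDictionary.monoThetaEnvCompat_kummerOut`, p439828).  At the junction `ofThetaSettingData` it
applies verbatim with abc-iut-L2-t4's `identifiesPiY_ofThetaSettingData` / `kxRootNModCyclotome_ofThetaSettingData_of_constantsDictionary` /
`hopenX` from temperedness (p440765).  [cite: MochizukiEtTh2009, Thm 5.10 (iii) p.334–335 (PDF pp.108–109)] -/
theorem monoThetaEnvCompat_kummerOut_rep (hK : 𝔉.KxRootNModCyclotome) (h1 : 𝔉.SectionsFactor) (h3 : 𝔉.OuterActionLZ)
    (hsec : 𝔉.SgpCapSection) (hcs : 𝔉.SgpCupSection) (h8 : 𝔉.ConstantsEqNormalizer) (H : 𝔉.Facts)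
    (hY : 𝔉.IdentifiesPiY (Cu.thetaEnvData μ hC hS) ι.toMulEquiv)
    (hopenX : IsOpenMap fun x : D.PiTemp => (⟨D.aug x, D.aug_mem_GK x⟩ : D.GK))
    (Ψ : C₀ ≌ C₀) (β : Ψ.functor.obj 𝔉.BN ≅ 𝔉.BN) (ΨbiratAut : 𝔉.biratUnits 𝔉.BN ≃* 𝔉.biratUnits 𝔉.BN)
    (hii : 𝔉.PsiAutPreserves Ψ β ΨbiratAut) (ψY : 𝔉.PiX ≃ₜ* 𝔉.PiX)
    (hbase : ∀ g, 𝔉.autBase 𝔉.BN (𝔉.psiAut Ψ β (𝔉.sgpCap (𝔉.ρ g))) = 𝔉.ρ (ψY g))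
    (hψY : 𝔉.PiY.map ψY.toMulEquiv.toMonoidHom = 𝔉.PiY)
    (hψYdd : 𝔉.PiYdd.map ψY.toMulEquiv.toMonoidHom = 𝔉.PiYdd)
    (hΔY : ∀ y ∈ 𝔉.PiY, (Cu.thetaEnvData μ hC hS).aug (ι (ψY y)) = 1 ↔ (Cu.thetaEnvData μ hC hS).aug (ι y) = 1) :
    𝔉.MonoThetaEnvCompat h1 h3 hsec hcs h8 (α.kummerOut hK) Ψ β ψY hbase hψY hψYdd :=
  α.monoThetaEnvCompat_kummerOut_ofSetting_rep hK h1 h3 hsec hcs h8 Cu μ hC hS ι m (ν'.comp (Subgroup.inclusion hD.kxRootN_le)) H hY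
    hopenX hD.mu_compat (hD.nu_kummer hK) hD.roots_of_K Ψ β ΨbiratAut hii ψY hbase hψY hψYdd hΔY

/-- **[EtTh] Theorem 5.10 (ii) ∧ (iii) at the honest `K^×`-part `DK := kummerOut` from Theorem 5.7, Theorem 4.4 (iv) (both BY NAME, as
abc-iut-L2-t4's `Facts.psiAutPreserves_of_transports`), the bundled §5 facts, the ONE dictionary binder, and the clause for the representative
`ψY` only** — the dictionary-route twin of this seat's intrinsic `Facts.thm510_ii_iii_kummerOut` (p435038, which needs `hsemi` instead): NO
`hsemi`, NO Cor. 2.18 (i) ∀-form.  v2 (append-only).  [cite: MochizukiEtTh2009, Thm 5.10 (ii)(iii) p.333–335 (PDF pp.107–109); Thm 4.4 (iv) p.320 (PDF p.94)] -/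
theorem thm510_ii_iii_kummerOut_rep (H : 𝔉.Facts) (hK : 𝔉.KxRootNModCyclotome)
    (hY : 𝔉.IdentifiesPiY (Cu.thetaEnvData μ hC hS) ι.toMulEquiv)
    (hopenX : IsOpenMap fun x : D.PiTemp => (⟨D.aug x, D.aug_mem_GK x⟩ : D.GK))
    (Ψ : C₀ ≌ C₀) (β : Ψ.functor.obj 𝔉.BN ≅ 𝔉.BN) (ΨbiratAut : 𝔉.biratUnits 𝔉.BN ≃* 𝔉.biratUnits 𝔉.BN)
    (Ψbs : D₀ ⥤ D₀) [Ψbs.Faithful] (eΨ : Ψ.functor ⋙ 𝔉.base ≅ 𝔉.base ⋙ Ψbs)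
    (hsq : ∀ u : 𝔉.units 𝔉.BN, ∀ hu : 𝔉.psiAut Ψ β u ∈ 𝔉.units 𝔉.BN,
      ΨbiratAut (𝔉.unitsToBirat 𝔉.BN u) = 𝔉.unitsToBirat 𝔉.BN ⟨_, hu⟩)
    (hconst : 𝔉.constEmb.range.map ΨbiratAut.toMonoidHom = 𝔉.constEmb.range)
    (αA : Ψ.functor.obj 𝔉.AN ≅ 𝔉.AN) (eA : 𝔉.AN ≅ 𝔉.AN) (Dc Dp : Aut 𝔉.BN)
    (hRT : 𝔉.RootTransportWith Ψ αA β eA Dc Dp)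
    (θ : Aut (𝔉.base.obj 𝔉.BN) ≃* Aut (𝔉.base.obj 𝔉.BN)) (hST : 𝔉.StrvTransport Ψ αA eA θ)
    (hθY : 𝔉.imPiY.map θ.toMonoidHom = 𝔉.imPiY) (hθYdd : 𝔉.HB.map θ.toMonoidHom = 𝔉.HB)
    (ψY : 𝔉.PiX ≃ₜ* 𝔉.PiX)
    (hbase : ∀ g, 𝔉.autBase 𝔉.BN (𝔉.psiAut Ψ β (𝔉.sgpCap (𝔉.ρ g))) = 𝔉.ρ (ψY g))
    (hψY : 𝔉.PiY.map ψY.toMulEquiv.toMonoidHom = 𝔉.PiY)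
    (hψYdd : 𝔉.PiYdd.map ψY.toMulEquiv.toMonoidHom = 𝔉.PiYdd)
    (hΔY : ∀ y ∈ 𝔉.PiY, (Cu.thetaEnvData μ hC hS).aug (ι (ψY y)) = 1 ↔ (Cu.thetaEnvData μ hC hS).aug (ι y) = 1) :
    𝔉.PsiAutPreserves Ψ β ΨbiratAut ∧
      𝔉.MonoThetaEnvCompat H.sectionsFactor 𝔉.outerActionLZ_of H.sgpCapSection H.sgpCupSection
        H.constantsEqNormalizer (α.kummerOut hK) Ψ β ψY hbase hψY hψYdd :=
  have hii : 𝔉.PsiAutPreserves Ψ β ΨbiratAut :=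
    H.psiAutPreserves_of_transports Ψ β ΨbiratAut Ψbs eΨ hsq hconst αA eA Dc Dp hRT θ hST hθY hθYdd
  ⟨hii, hD.monoThetaEnvCompat_kummerOut_rep hK H.sectionsFactor 𝔉.outerActionLZ_of H.sgpCapSection H.sgpCupSection
    H.constantsEqNormalizer H hY hopenX Ψ β ΨbiratAut hii ψY hbase hψY hψYdd hΔY⟩

end ConstantsDictionary

end BiratAutAction

end ThetaFrobenioid

end Literature.AnabelianGeometry.EtaleTheta

end
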